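import Mathlib
import Summits.NavierStokesRegularity.NavierStokesRegularity.Theorems.EulerZoomLiouvillePowerGaugeEulerLiouvilleAnchoredBudgetFloorPath
import HarnessLib

/-!
# Crux `EulerZoomLiouville.PowerGaugeEulerLiouville` (stmt-NavierStokesRegularity-19832), line `anchored-budget` REV3, stub C1 — part 1:
# ALONG ONE CURVE: the backward Grönwall floor and the no-escape displacement, WITHOUT a flow clause

Route №10 `EulerZoomLiouville` (NavierStokesRegularity), crux E.  Line `anchored-budget` (ideator ns-idea-11 g4;
`Cruxes/PowerGaugeEulerLiouville/Lines/anchored_budget.lean`, REV3 = text of record, critic V37b: `IsAnchorablePast u p T₁ :=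
classical ∧ T₁ ≤ 0`, NO flow-owning clause), stub C1 `stub_anchoredFloorTransport` (seat ns-sfl-p1 g4).  The REV2 proof
(`…AnchoredBudgetFloorPath`, `…AnchoredBudgetFloor`, p628927/p629380) ran the GLOBAL particle flow of `u`, which needs the gradient of `u`
bounded on compact time sets uniformly in space.  REV3 follows labels only while they stay inside a bounded ball, so the two pathwise
ingredients are re-proved here for ONE CURVE `γ : [t₁,t₀] → ℝ³` (no flow, no global Lipschitz hypothesis):

* `sq_norm_curl_floor_along_curve` — **BACKWARD GRÖNWALL FLOOR along a `u`-trajectory**: if `γ' = u(s, γ s)` on `[t₁,t₀] ⊆ (−∞,0)` and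
  `⟪∇u(τ,x) ω, ω⟫ ≤ (K/(−τ) + Λ(τ))|ω|²` on `[t₁,t₀] × ℝ³` with `Λ` integrable, then
  `|ω(t₁, γ t₁)|² ≥ |ω(t₀, γ t₀)|² · e^{−2∫_{(t₁,t₀)} Λ} · ((−t₀)/(−t₁))^{2K}`; the vorticity equation along the curve
  (`hasDerivWithinAt_curl_flow` on the time set `[t₁,t₀]`) gives `(log |ω|²)' ≤ 2K/(−τ) + 2Λ`; `|ω| > 0` along the curve by the crude
  Grönwall bound with the gradient bound ALONG THE CURVE, which holds by continuity on the compact interval (no spatial clause);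
* `half_le_lintegral_of_escape_curve` — **NO-ESCAPE DISPLACEMENT** (Crippa–De Lellis), generic: a curve with velocity `v`, `‖γ t₀‖ < a/2`,
  reaching `‖·‖ ≥ a` at some time of `[t₁,t₀]`, has `a/2 ≤ ∫_{[t₁,t₀]} 1_{STAY(s)} ‖v s‖ ds`, where `STAY(s)` = «`‖γ σ‖ < a` for all
  `σ ∈ [s,t₀]`» (after the LAST exit time the path runs inside the ball from norm `a` to norm `< a/2`).

WHAT THIS IS NOT: not NS, not the crux E — pathwise calculus `--supports` stmt-19832 for ONE stub of ONE line; 19832 OPEN.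
[cite: CrippaDeLellis2008, §2–3; MajdaBertozziCUP2002, §1.6 (1.51), §2.5 (2.115)–(2.117)]
-/

noncomputable section

-- flat `Theorems/<Route><Decl>…` files of one crux share the namespace of the crux (tree convention)
set_option linter.dupNamespace false

open MeasureTheory Set Filter Topology Metric Function InnerProductSpace
open scoped RealInnerProductSpace NNReal ENNReal

namespace Summit.NavierStokesRegularity.NavierStokesRegularity.Theorems.PowerGaugeEulerLiouville.AnchoredBudget

open Literature.Analysis Literature.Analysis.FluidPDE Literature.Analysis.ODE

variable {u : ℝ → EuclideanSpace ℝ (Fin 3) → EuclideanSpace ℝ (Fin 3)} {p : ℝ → EuclideanSpace ℝ (Fin 3) → ℝ}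

/-! ### The backward Grönwall floor along one curve -/

/-- **Backward Grönwall floor under a stretching budget, along ONE `u`-trajectory** (no flow clause).  For `t₁ < t₀ < 0`, a curve
`γ` with `γ' = u(s, γ s)` at every `s ∈ [t₁,t₀]`, a budget `⟪∇u(τ,x)ω,ω⟫ ≤ (K/(−τ) + Λ(τ))|ω|²` on `[t₁,t₀] × ℝ³` with `Λ` integrable
on `[t₁,t₀]`: `|ω(t₀, γ t₀)|² e^{−2∫_{(t₁,t₀)}Λ} ((−t₀)/(−t₁))^{2K} ≤ |ω(t₁, γ t₁)|²`.  The gradient bound along the curve needed to keep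
`|ω| > 0` comes from continuity on the compact interval. [cite: MajdaBertozziCUP2002, §1.6 (1.51), §2.5 (2.115)–(2.117)] -/
theorem sq_norm_curl_floor_along_curve (hcl : IsClassicalEulerSolutionOn (Iio 0) 0 u p)
    {t₁ t₀ : ℝ} (h10 : t₁ < t₀) (ht₀ : t₀ < 0)
    {γ : ℝ → EuclideanSpace ℝ (Fin 3)} (hγ : ∀ s ∈ Icc t₁ t₀, HasDerivAt γ (u s (γ s)) s)
    {K : ℝ} {Λ : ℝ → ℝ} (hΛi : IntegrableOn Λ (Icc t₁ t₀))
    (hS : ∀ τ ∈ Icc t₁ t₀, ∀ x : EuclideanSpace ℝ (Fin 3),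
      ⟪fderiv ℝ (u τ) x (curl (u τ) x), curl (u τ) x⟫ ≤ (K / (-τ) + Λ τ) * ‖curl (u τ) x‖ ^ 2) :
    ‖curl (u t₀) (γ t₀)‖ ^ 2 * Real.exp (-(2 * ∫ s in Ioo t₁ t₀, Λ s)) * ((-t₀) / (-t₁)) ^ (2 * K) ≤
      ‖curl (u t₁) (γ t₁)‖ ^ 2 := by
  by_cases h0 : curl (u t₀) (γ t₀) = 0
  · rw [h0, norm_zero]; simp only [ne_eq, OfNat.ofNat_ne_zero, not_false_eq_true, zero_pow, zero_mul]; positivity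
  set I : Set ℝ := Icc t₁ t₀ with hI
  have hIU : UniqueDiffOn ℝ I := uniqueDiffOn_Icc h10
  have hIcc : I ⊆ Iio (0 : ℝ) := fun s hs => lt_of_le_of_lt hs.2 ht₀
  have hclI : IsClassicalEulerSolutionOn I 0 u p := hcl.mono hIcc hIU
  have ht₀I : t₀ ∈ I := right_mem_Icc.2 h10.le
  have ht₁I : t₁ ∈ I := left_mem_Icc.2 h10.le
  -- `c = ω` along the curve, `A = ∇u` along the curve, `m = |c|²`
  set c : ℝ → EuclideanSpace ℝ (Fin 3) := fun s => curl (u s) (γ s) with hc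
  set A : ℝ → EuclideanSpace ℝ (Fin 3) →L[ℝ] EuclideanSpace ℝ (Fin 3) := fun s => fderiv ℝ (u s) (γ s) with hA
  have hc' : ∀ s ∈ I, HasDerivWithinAt c (A s (c s)) I s := fun s hs =>
    hclI.hasDerivWithinAt_curl_flow hIU (X := fun r (_ : EuclideanSpace ℝ (Fin 3)) => γ r)
      (fun t ht _ => (hγ t ht).hasDerivWithinAt) hs (γ t₀)
  set m : ℝ → ℝ := fun s => ‖c s‖ ^ 2 with hm
  have hm' : ∀ s ∈ I, HasDerivWithinAt m (2 * ⟪c s, A s (c s)⟫) I s := fun s hs => (hc' s hs).norm_sq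
  have hmt₀ : m t₀ = ‖curl (u t₀) (γ t₀)‖ ^ 2 := rfl
  have hmt₀pos : 0 < m t₀ := by rw [hmt₀]; exact pow_pos (norm_pos_iff.2 h0) 2
  -- continuity of the data along the curve on `[t₁,t₀]`
  have hγc : ContinuousOn γ I := fun s hs => (hγ s hs).continuousAt.continuousWithinAt
  have hcc : ContinuousOn c I := fun s hs => (hc' s hs).continuousWithinAt
  have hmc : ContinuousOn m I := hcc.norm.pow 2
  have hAc : ContinuousOn A I := by
    have h1 := (hcl.smooth_velocity.fderiv_slice (uniqueDiffOn_Iio 0)).continuousOn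
    have h2 : ContinuousOn (fun s : ℝ => ((s, γ s) : ℝ × EuclideanSpace ℝ (Fin 3))) I := continuousOn_id.prodMk hγc
    exact h1.comp h2 fun s hs => mk_mem_prod (hIcc hs) (mem_univ _)
  have hqc : ContinuousOn (fun s => 2 * ⟪c s, A s (c s)⟫) I :=
    continuousOn_const.mul (hcc.inner (hAc.clm_apply hcc))
  -- Step 1: a gradient bound ALONG THE CURVE (compactness), hence `m > 0` on `[t₁,t₀]` (crude Grönwall)
  obtain ⟨Lg, hLg⟩ := isCompact_Icc.exists_bound_of_continuousOn hAc
  have hLg0 : 0 ≤ Lg := (norm_nonneg _).trans (hLg t₀ ht₀I)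
  have hqle : ∀ s ∈ I, 2 * ⟪c s, A s (c s)⟫ ≤ 2 * Lg * m s := by
    intro s hs
    have h1 : ⟪c s, A s (c s)⟫ ≤ ‖c s‖ * ‖A s (c s)‖ := real_inner_le_norm _ _
    have h2 : ‖A s (c s)‖ ≤ Lg * ‖c s‖ := (A s).le_of_opNorm_le (hLg s hs) _
    have h3 : m s = ‖c s‖ ^ 2 := rfl
    nlinarith [norm_nonneg (c s)]
  set F₁ : ℝ → ℝ := fun s => Real.exp (2 * Lg * (t₀ - s)) * m s with hF₁
  have hE' : ∀ s : ℝ, HasDerivAt (fun r : ℝ => Real.exp (2 * Lg * (t₀ - r))) (Real.exp (2 * Lg * (t₀ - s)) * (2 * Lg * (-1))) s := by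
    intro s
    have h := ((hasDerivAt_id s).const_sub t₀).const_mul (2 * Lg)
    exact (h.exp).congr_deriv (by simp)
  have hF₁' : ∀ s ∈ I, HasDerivWithinAt F₁
      (Real.exp (2 * Lg * (t₀ - s)) * (2 * Lg * (-1)) * m s + Real.exp (2 * Lg * (t₀ - s)) * (2 * ⟪c s, A s (c s)⟫)) I s :=
    fun s hs => (hE' s).hasDerivWithinAt.mul (hm' s hs)
  have hanti : AntitoneOn F₁ I := by
    refine antitoneOn_of_hasDerivWithinAt_nonpos (convex_Icc t₁ t₀)
      (fun s hs => (hF₁' s hs).continuousWithinAt)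
      (fun s hs => (hF₁' s (interior_subset hs)).mono interior_subset) fun s hs => ?_
    have hs' : s ∈ I := interior_subset hs
    have hpos := Real.exp_pos (2 * Lg * (t₀ - s))
    have := hqle s hs'
    nlinarith [mul_le_mul_of_nonneg_left this hpos.le]
  have hmpos : ∀ s ∈ I, 0 < m s := by
    intro s hs
    have h1 : F₁ t₀ ≤ F₁ s := hanti hs ht₀I hs.2
    have h2 : F₁ t₀ = m t₀ := by simp only [hF₁, sub_self, mul_zero, Real.exp_zero, one_mul]
    rw [h2] at h1
    have hpos := Real.exp_pos (2 * Lg * (t₀ - s))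
    by_contra hneg
    rw [not_lt] at hneg
    have : F₁ s ≤ 0 := mul_nonpos_of_nonneg_of_nonpos hpos.le hneg
    linarith
  -- Step 2: `(log m)' ≤ 2K/(−s) + 2Λ`, integrated on `[t₁,t₀]`
  set f : ℝ → ℝ := fun s => Real.log (m s) with hf
  have hf' : ∀ s ∈ I, HasDerivWithinAt f (2 * ⟪c s, A s (c s)⟫ / m s) I s := by
    intro s hs
    have h := (Real.hasDerivAt_log (hmpos s hs).ne').comp_hasDerivWithinAt s (hm' s hs)
    exact h.congr_deriv (by rw [div_eq_inv_mul])
  have hfc : ContinuousOn f I := fun s hs => (hf' s hs).continuousWithinAt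
  have hf'c : ContinuousOn (fun s => 2 * ⟪c s, A s (c s)⟫ / m s) I :=
    hqc.div hmc fun s hs => (hmpos s hs).ne'
  have hFTC : ∫ s in t₁..t₀, 2 * ⟪c s, A s (c s)⟫ / m s = f t₀ - f t₁ :=
    intervalIntegral.integral_eq_sub_of_hasDeriv_right_of_le h10.le hfc
      (fun s hs => ((hf' s (Ioo_subset_Icc_self hs)).hasDerivAt (Icc_mem_nhds hs.1 hs.2)).hasDerivWithinAt)
      (hf'c.intervalIntegrable_of_Icc h10.le)
  have hbound : ∀ s ∈ I, 2 * ⟪c s, A s (c s)⟫ / m s ≤ 2 * (K / (-s) + Λ s) := by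
    intro s hs
    rw [div_le_iff₀ (hmpos s hs)]
    have h := hS s hs (γ s)
    rw [real_inner_comm] at h
    have h3 : m s = ‖c s‖ ^ 2 := rfl
    rw [h3]
    nlinarith
  have ht₁0 : t₁ < 0 := h10.trans ht₀
  have hgi : IntervalIntegrable (fun s => 2 * (K / (-s) + Λ s)) volume t₁ t₀ := by
    refine ((ContinuousOn.intervalIntegrable_of_Icc h10.le ?_).add ?_).const_mul 2
    · exact continuousOn_const.div continuousOn_id.neg fun s hs => by have := hIcc hs; simp only [mem_Iio] at this; linarith
    · exact (hΛi.mono_set (by rw [uIcc_of_le h10.le])).intervalIntegrable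
  have hmono := intervalIntegral.integral_mono_on h10.le (hf'c.intervalIntegrable_of_Icc h10.le) hgi hbound
  have hval : ∫ s in t₁..t₀, 2 * (K / (-s) + Λ s) = -(2 * K) * Real.log (t₀ / t₁) + 2 * ∫ s in t₁..t₀, Λ s := by
    have hI1 : IntervalIntegrable (fun s : ℝ => K / (-s)) volume t₁ t₀ :=
      ContinuousOn.intervalIntegrable_of_Icc h10.le
        (continuousOn_const.div continuousOn_id.neg fun s hs => by have := hIcc hs; simp only [mem_Iio] at this; linarith)
    have hI2 : IntervalIntegrable Λ volume t₁ t₀ := (hΛi.mono_set (by rw [uIcc_of_le h10.le])).intervalIntegrable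
    have e1 : (fun s : ℝ => 2 * (K / (-s) + Λ s)) = fun s => 2 * (K / (-s)) + 2 * Λ s := by funext s; ring
    rw [e1, intervalIntegral.integral_add (hI1.const_mul 2) (hI2.const_mul 2), intervalIntegral.integral_const_mul,
      intervalIntegral.integral_const_mul]
    have e2 : (fun s : ℝ => K / (-s)) = fun s => -K * s⁻¹ := by funext s; rw [div_neg, div_eq_mul_inv, neg_mul]
    rw [e2, intervalIntegral.integral_const_mul, integral_inv_of_neg ht₁0 ht₀]
    ring
  rw [hFTC, hval] at hmono
  -- Step 3: exponentiate
  have hratio : 0 < t₀ / t₁ := div_pos_of_neg_of_neg ht₀ ht₁0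
  have hIoo : ∫ s in Ioo t₁ t₀, Λ s = ∫ s in t₁..t₀, Λ s := by
    rw [intervalIntegral.integral_of_le h10.le, integral_Ioc_eq_integral_Ioo]
  have hm₁ : m t₁ = ‖curl (u t₁) (γ t₁)‖ ^ 2 := rfl
  rw [← hm₁, ← hmt₀, hIoo, show (-t₀) / (-t₁) = t₀ / t₁ by rw [neg_div_neg_eq], Real.rpow_def_of_pos hratio,
    ← Real.exp_log hmt₀pos, ← Real.exp_add, ← Real.exp_add, ← Real.exp_log (hmpos t₁ ht₁I)]
  rw [Real.exp_le_exp]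
  have e3 : f t₀ = Real.log (m t₀) := rfl
  have e4 : f t₁ = Real.log (m t₁) := rfl
  linarith

/-! ### No escape without displacement, along one curve -/

/-- **A curve that escapes `B(0,a)` has travelled `a/2` inside it, during its final stay** (the step behind the Crippa–De Lellis
no-escape bound; generic — any curve with a continuous velocity `v` on `[t₁,t₀]`): if `‖γ t₀‖ < a/2` and `‖γ s‖ ≥ a` for some
`s ∈ [t₁,t₀]`, then `a/2 ≤ ∫_{[t₁,t₀]} 1_{STAY}(s) ‖v s‖ ds`, `STAY = {s : ‖γ σ‖ < a for all σ ∈ [s,t₀]}` (after the LAST exit time the path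
runs inside the ball from norm `a` to norm `< a/2`, and those times are STAY times). [cite: CrippaDeLellis2008, §2 (no-escape estimate)] -/
theorem half_le_lintegral_of_escape_curve {t₁ t₀ a : ℝ} {γ v : ℝ → EuclideanSpace ℝ (Fin 3)}
    (hγ : ∀ s ∈ Icc t₁ t₀, HasDerivAt γ (v s) s) (hvc : ContinuousOn v (Icc t₁ t₀))
    (hξ : ‖γ t₀‖ < a / 2) (hesc : ∃ s ∈ Icc t₁ t₀, a ≤ ‖γ s‖) :
    ENNReal.ofReal (a / 2) ≤
      ∫⁻ s in Icc t₁ t₀, {s | ∀ σ ∈ Icc s t₀, ‖γ σ‖ < a}.indicator (fun s => ‖v s‖ₑ) s := by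
  have hγc : ContinuousOn γ (Icc t₁ t₀) := fun s hs => (hγ s hs).continuousAt.continuousWithinAt
  -- the last exit time `σ₀`
  set S' : Set ℝ := Icc t₁ t₀ ∩ (fun s => ‖γ s‖) ⁻¹' Ici a with hS'
  have hS'cl : IsClosed S' := hγc.norm.preimage_isClosed_of_isClosed isClosed_Icc isClosed_Ici
  have hS'c : IsCompact S' := isCompact_Icc.of_isClosed_subset hS'cl inter_subset_left
  obtain ⟨s₁, hs₁, hfar⟩ := hesc
  have hne : S'.Nonempty := ⟨s₁, hs₁, hfar⟩
  set σ₀ : ℝ := sSup S' with hσ₀def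
  have hσ₀ : σ₀ ∈ S' := hS'c.sSup_mem hne
  have hσ₀le : ∀ s ∈ S', s ≤ σ₀ := fun s hs => le_csSup hS'c.bddAbove hs
  have hσ₀a : a ≤ ‖γ σ₀‖ := hσ₀.2
  have hσ₀t₀ : σ₀ < t₀ := by
    rcases hσ₀.1.2.eq_or_lt with h | h
    · exfalso; rw [h] at hσ₀a; linarith [norm_nonneg (γ t₀)]
    · exact h
  have hin : ∀ s ∈ Ioc σ₀ t₀, ‖γ s‖ < a := by
    intro s hs
    by_contra h
    rw [not_lt] at h
    exact absurd (hσ₀le s ⟨⟨hσ₀.1.1.trans hs.1.le, hs.2⟩, h⟩) (not_le.2 hs.1)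
  have hstay : ∀ s ∈ Ioc σ₀ t₀, s ∈ {s | ∀ σ ∈ Icc s t₀, ‖γ σ‖ < a} := fun s hs σ hσ =>
    hin σ ⟨lt_of_lt_of_le hs.1 hσ.1, hσ.2⟩
  -- FTC on `[σ₀, t₀]` and the triangle inequality
  have hIcc' : Icc σ₀ t₀ ⊆ Icc t₁ t₀ := Icc_subset_Icc_left hσ₀.1.1
  have hderiv : ∀ s ∈ uIcc σ₀ t₀, HasDerivAt γ (v s) s := fun s hs =>
    hγ s (hIcc' (by rwa [uIcc_of_le hσ₀t₀.le] at hs))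
  have hvc' : ContinuousOn v (Icc σ₀ t₀) := hvc.mono hIcc'
  have hFTC := intervalIntegral.integral_eq_sub_of_hasDerivAt hderiv (hvc'.intervalIntegrable_of_Icc hσ₀t₀.le)
  have hnorm : a / 2 ≤ ∫ s in σ₀..t₀, ‖v s‖ := by
    have h1 : ‖γ σ₀‖ - ‖γ t₀‖ ≤ ‖γ t₀ - γ σ₀‖ := by
      rw [← norm_neg (γ t₀ - γ σ₀), neg_sub]; exact norm_sub_norm_le _ _
    have h2 : ‖γ t₀ - γ σ₀‖ ≤ ∫ s in σ₀..t₀, ‖v s‖ := by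
      rw [← hFTC]; exact intervalIntegral.norm_integral_le_integral_norm hσ₀t₀.le
    linarith
  -- pass to the Lebesgue integral over `Ioc σ₀ t₀ ⊆ Icc t₁ t₀` and insert the indicator
  have hint : IntegrableOn (fun s => ‖v s‖) (Ioc σ₀ t₀) := (hvc'.norm.integrableOn_Icc).mono_set Ioc_subset_Icc_self
  have h3 : ENNReal.ofReal (∫ s in σ₀..t₀, ‖v s‖) = ∫⁻ s in Ioc σ₀ t₀, ‖v s‖ₑ := by
    rw [intervalIntegral.integral_of_le hσ₀t₀.le, ofReal_integral_eq_lintegral_ofReal hint (Eventually.of_forall fun s => norm_nonneg _)]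
    simp_rw [ofReal_norm]
  calc ENNReal.ofReal (a / 2) ≤ ENNReal.ofReal (∫ s in σ₀..t₀, ‖v s‖) := ENNReal.ofReal_le_ofReal hnorm
    _ = ∫⁻ s in Ioc σ₀ t₀, ‖v s‖ₑ := h3
    _ = ∫⁻ s in Ioc σ₀ t₀, {s | ∀ σ ∈ Icc s t₀, ‖γ σ‖ < a}.indicator (fun s => ‖v s‖ₑ) s := by
        refine setLIntegral_congr_fun measurableSet_Ioc fun s hs => ?_
        rw [indicator_of_mem (hstay s hs)]
    _ ≤ ∫⁻ s in Icc t₁ t₀, {s | ∀ σ ∈ Icc s t₀, ‖γ σ‖ < a}.indicator (fun s => ‖v s‖ₑ) s :=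
        lintegral_mono_set fun s hs => ⟨hσ₀.1.1.trans hs.1.le, hs.2⟩

end Summit.NavierStokesRegularity.NavierStokesRegularity.Theorems.PowerGaugeEulerLiouville.AnchoredBudget

end
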